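import Summits.HodgeConjecture.HodgeConjecture.Theorems.LinearSystemTorelliLocalTubeSpanFrameLiftBasic
import Summits.HodgeConjecture.HodgeConjecture.Theorems.LinearSystemTorelliLocalTubeSpanFrameLiftCounting
import Summits.HodgeConjecture.HodgeConjecture.Theorems.LinearSystemTorelliLocalTubeSpanCongruenceLemmas
import Mathlib.LinearAlgebra.LinearIndependent.Lemmas

/-!
# Route LinearSystemTorelli — crux `LocalTubeSpan` (stmt-HodgeConjecture-2490): a star basis inside a skew vanishing lattice, and its orbit lattice

Helper file (`--supports stmt-HodgeConjecture-2490`, line `Sketch` of the crux chain; continuation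
lead c5; second preparation file for discharging `Schnell2010_lemma11` (nondegenerate case) from
Janssen's Theorem 2.5 (= [Schnell2010] Thm. 10) and Theorem 2.9).

The first two steps of the proof of [Schnell2010] §7 Lemma 11, with Janssen's Lemma 2.7 (the set
`Δ₁ = {δ : ⟨δ₁, δ⟩ = 1} ∪ {δ₁}` generates) replaced by the tree's named fact `Janssen1983_thm2_9`
(`x ∈ Δ ↔ (∃ y, ⟨x, y⟩ = 1) ∧ x ≡ δ (mod 2ℤΔ)`), whose source is held verbatim:

* `localTubeSpan_exists_starBasis` — granting Theorem 2.9, a skew vanishing lattice `Δ` contains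
  a `ℚ`-basis `δ₀, …` of `V` all of whose members pair to `1` with a distinguished member `δ_{i₀}`
  (a STAR for the unimodular graph): the companions `δ₁ + 2Nu ∈ Δ` (`u ⟂ δ₂`) span `δ₂^⟂`;
* `localTubeSpan_starOrbit_isSkewVanishingLattice` — for such a star basis the orbit
  `Δ' = Γ' · {δᵢ}` of the basis under its own transvection group `Γ' = Γ_{δ_•}` is a skew vanishing
  lattice with `Γ_{Δ'} = Γ'`, `Δ' ⊆ Δ` and `ℤΔ' = ℤδ_•` (`T_c T_δᵢ c = δᵢ` puts the basis in one
  orbit) — the lattice to which Janssen's Theorem 2.5 is applied in Schnell's proof.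

Named fact used: `Janssen1983_thm2_9` (hypothesis `h29`); no `sorry`.
-/

-- `Summit.HodgeConjecture.HodgeConjecture.Theorems` is the mandated namespace (single-conjunct summit:
-- Sub = Summit), which `linter.dupNamespace` flags on every declaration; the lakefile turns the
-- linter off tree-wide (weak option), restated here so stand-alone elaboration is warning-free too.
set_option linter.dupNamespace false

noncomputable section

open Literature.AlgebraicGeometry.HodgeTheory

namespace Summit.HodgeConjecture.HodgeConjecture.Theorems

variable {V : Type} [AddCommGroup V] [Module ℚ V]

/-! ### A star basis -/

/-- **A star basis inside a skew vanishing lattice** (granting Janssen's Theorem 2.9).  A skew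
vanishing lattice `Δ` in the finite-dimensional `ℚ`-space `V` (alternating `B`) contains linearly
independent `δ₀, …, δ_{r-1}`, `r = dim V`, and an index `i₀` with `⟨δᵢ, δ_{i₀}⟩ = 1` for all
`i ≠ i₀`.  Proof: take `⟨δ₁, δ₂⟩ = 1` in `Δ` and `c = δ₂`; by Theorem 2.9 every `δ₁ + 2Nu` with
`Nu ∈ ℤΔ`, `⟨u, c⟩ = 0`, lies in `Δ` (it pairs to `1` with `c` and is `≡ δ₁ mod 2ℤΔ`), so the
elements of `Δ` pairing to `1` with `c` span `ℚδ₁ + c^⟂ = V`; extend `{c}` to a basis inside them.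
[cite: Schnell2010, §7 Lemma 11 (proof, first step)] -/
theorem localTubeSpan_exists_starBasis (h29 : Janssen1983_thm2_9) [FiniteDimensional ℚ V]
    (B : LinearMap.BilinForm ℚ V) (hB : B.IsAlt) (Δ : Set V) (hΔ : IsSkewVanishingLattice B Δ) :
    ∃ (r : ℕ) (δ : Fin r → V) (i₀ : Fin r), r = Module.finrank ℚ V ∧ (∀ i, δ i ∈ Δ) ∧
      LinearIndependent ℚ δ ∧ ∀ i, i ≠ i₀ → B (δ i) (δ i₀) = 1 := by
  classical
  obtain ⟨δ₁, hδ₁, c, hc, h1c⟩ := hΔ.exists_pair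
  set Λ : Submodule ℤ V := Submodule.span ℤ Δ with hΛdef
  have hΛspan : Submodule.span ℚ (Λ : Set V) = ⊤ := by
    rw [hΛdef, Submodule.span_span_of_tower]; exact hΔ.span_eq_top
  -- the elements of `Δ` pairing to `1` with `c`
  set Δ₁ : Set V := {x | x ∈ Δ ∧ B x c = 1} with hΔ₁def
  have hδ₁Δ₁ : δ₁ ∈ Δ₁ := ⟨hδ₁, h1c⟩
  -- companions `δ₁ + 2 N u ∈ Δ₁` for `u ⟂ c`
  have hcomp : ∀ u : V, B u c = 0 → ∃ N : ℕ, 0 < N ∧ δ₁ + (2 * (N : ℚ)) • u ∈ Δ₁ := by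
    intro u hu
    obtain ⟨N, hNpos, hNu⟩ := localTubeSpan_exists_nsmul_mem_of_span_eq_top Λ hΛspan u
    refine ⟨N, hNpos, ?_, ?_⟩
    · have hδ₁Λ : δ₁ ∈ Λ := Submodule.subset_span hδ₁
      have hxΛ : δ₁ + (2 * (N : ℚ)) • u ∈ Λ := by
        rw [mul_smul, show ((N : ℚ)) • u = ((N : ℤ)) • u from
          (Int.cast_smul_eq_zsmul ℚ (N : ℤ) u).symm.trans (by rw [Int.cast_natCast]) |>.symm,
          show (2 : ℚ) • ((N : ℤ) • u) = (2 : ℤ) • ((N : ℤ) • u) from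
            (Int.cast_smul_eq_zsmul ℚ 2 _).symm.trans (by norm_num) |>.symm]
        exact Λ.add_mem hδ₁Λ (Λ.smul_mem _ hNu)
      refine (h29 V B hB Δ hΔ _ hxΛ).2 ⟨⟨c, Submodule.subset_span hc, ?_⟩, δ₁, hδ₁, (N : ℤ) • u, hNu, ?_⟩
      · rw [map_add, map_smul, LinearMap.add_apply, LinearMap.smul_apply, h1c, hu, smul_zero, add_zero]
      · rw [add_sub_cancel_left, two_nsmul, mul_smul, ← Int.cast_smul_eq_zsmul ℚ (N : ℤ) u,
          Int.cast_natCast, two_smul]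
    · rw [map_add, map_smul, LinearMap.add_apply, LinearMap.smul_apply, h1c, hu, smul_zero, add_zero]
  -- `Δ₁` spans `V`
  have hΔ₁span : Submodule.span ℚ Δ₁ = ⊤ := by
    refine eq_top_iff.2 fun v _ => ?_
    -- `v = (B v c) • δ₁ + u` with `u ⟂ c`
    set u : V := v - (B v c) • δ₁ with hudef
    have hu : B u c = 0 := by
      rw [hudef, map_sub, map_smul, LinearMap.sub_apply, LinearMap.smul_apply, h1c, smul_eq_mul,
        mul_one, sub_self]
    obtain ⟨N, hNpos, hN⟩ := hcomp u hu
    have hN0 : (2 * (N : ℚ)) ≠ 0 := by positivity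
    have huspan : u ∈ Submodule.span ℚ Δ₁ := by
      have e1 : u = (2 * (N : ℚ))⁻¹ • ((δ₁ + (2 * (N : ℚ)) • u) - δ₁) := by
        rw [add_sub_cancel_left, smul_smul, inv_mul_cancel₀ hN0, one_smul]
      rw [e1]
      exact Submodule.smul_mem _ _ (Submodule.sub_mem _ (Submodule.subset_span hN)
        (Submodule.subset_span hδ₁Δ₁))
    have e2 : v = (B v c) • δ₁ + u := by rw [hudef]; abel
    rw [e2]
    exact Submodule.add_mem _ (Submodule.smul_mem _ _ (Submodule.subset_span hδ₁Δ₁)) huspan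
  -- extend `{c}` to a basis inside `{c} ∪ Δ₁`
  have hc0 : c ≠ 0 := by
    intro h0; rw [h0, map_zero] at h1c; exact zero_ne_one h1c
  have hcli : LinearIndepOn ℚ id ({c} : Set V) := (linearIndepOn_singleton_iff ℚ).2 hc0
  obtain ⟨b, hbsub, hcb, hbspan, hbli⟩ :=
    exists_linearIndepOn_id_extension hcli (Set.subset_union_left (t := Δ₁))
  have hbtop : Submodule.span ℚ b = ⊤ := by
    refine eq_top_iff.2 ?_
    rw [← hΔ₁span, Submodule.span_le]
    exact fun x hx => hbspan (Or.inr hx)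
  have hbfin : b.Finite := LinearIndependent.set_finite_of_isNoetherian hbli
  obtain ⟨r, f, hf⟩ := hbfin.fin_embedding
  have hfli : LinearIndependent ℚ f := by
    rw [← linearIndepOn_id_range_iff f.injective, hf]; exact hbli
  have hr : r = Module.finrank ℚ V := by
    have htop : Submodule.span ℚ (Set.range f) = ⊤ := by rw [hf, hbtop]
    have h1 := hfli.fintype_card_le_finrank
    have h2 := finrank_le_of_span_eq_top htop
    rw [Fintype.card_fin] at h1 h2
    omega
  have hcb' : c ∈ Set.range f := by rw [hf]; exact hcb (Set.mem_singleton c)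
  obtain ⟨i₀, hi₀⟩ := hcb'
  refine ⟨r, f, i₀, hr, fun i => ?_, hfli, fun i hi => ?_⟩
  · have hfi : f i ∈ b := hf ▸ Set.mem_range_self i
    rcases hbsub hfi with h | h
    · rw [Set.mem_singleton_iff.1 h]; exact hc
    · exact h.1
  · have hfi : f i ∈ b := hf ▸ Set.mem_range_self i
    have hne : f i ≠ c := fun h => hi (f.injective (h.trans hi₀.symm))
    rcases hbsub hfi with h | h
    · exact absurd (Set.mem_singleton_iff.1 h) hne
    · rw [hi₀]; exact h.2

/-! ### The orbit lattice of a star basis -/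

/-- `T_c (T_δ c) = δ` when `⟨δ, c⟩ = 1` (alternating `B`): the two-step move putting `δ` in the orbit of
the centre `c` of a star. [folklore] -/
theorem localTubeSpan_star_move (B : LinearMap.BilinForm ℚ V) (hB : B.IsAlt) {δ c : V}
    (h : B δ c = 1) :
    skewTransvection B c (skewTransvection B δ c) = δ := by
  have hcδ : B c δ = -1 := by rw [← hB.neg_eq, h]
  rw [skewTransvection_apply, skewTransvection_apply, hcδ, neg_smul, one_smul, sub_neg_eq_add,
    map_add, LinearMap.add_apply, hB.self_eq_zero, h, zero_add, one_smul, add_sub_cancel_left]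

/-- **The orbit lattice of a star basis.**  Let `δ : Fin r → V` be linearly independent, spanning,
contained in the skew vanishing lattice `Δ` (alternating `B`), with a centre `i₀` such that
`⟨δᵢ, δ_{i₀}⟩ = 1` for `i ≠ i₀`, and some `i₁ ≠ i₀`.  Let `Γ' = Γ_{δ_•}` and
`Δ' = Γ' · {δᵢ}`.  Then `Δ' ⊆ Δ`, `ℤΔ' = ℤδ_•`, `Γ_{Δ'} = Γ'`, and `Δ'` is a skew vanishing lattice
for `B` (single orbit: `δᵢ = T_c T_δᵢ c`; pair `⟨δ_{i₁}, c⟩ = 1`) — the lattice "`Δ' ⊆ V'`" of the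
proof of [Schnell2010] §7 Lemma 11. [cite: Schnell2010, §7 Lemma 11 (proof)] -/
theorem localTubeSpan_starOrbit_isSkewVanishingLattice (B : LinearMap.BilinForm ℚ V) (hB : B.IsAlt)
    (Δ : Set V) (hΔ : IsSkewVanishingLattice B Δ) {r : ℕ} (δ : Fin r → V) (hδΔ : ∀ i, δ i ∈ Δ)
    (hsp : Submodule.span ℚ (Set.range δ) = ⊤) (i₀ i₁ : Fin r) (hi₁ : i₁ ≠ i₀)
    (hstar : ∀ i, i ≠ i₀ → B (δ i) (δ i₀) = 1) (Δ' : Set V)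
    (hΔ' : Δ' = {x | ∃ g ∈ transvectionGroup B (Set.range δ), ∃ i,
      ((g : (V →ₗ[ℚ] V)ˣ) : V →ₗ[ℚ] V) (δ i) = x}) :
    Δ' ⊆ Δ ∧ Submodule.span ℤ Δ' = Submodule.span ℤ (Set.range δ) ∧
      transvectionGroup B Δ' = transvectionGroup B (Set.range δ) ∧ IsSkewVanishingLattice B Δ' := by
  classical
  set Γ' := transvectionGroup B (Set.range δ) with hΓ'def
  have hδsub : Set.range δ ⊆ Δ := by rintro _ ⟨i, rfl⟩; exact hδΔ i
  have hΓ'Γ : Γ' ≤ transvectionGroup B Δ := transvectionGroup_mono B hδsub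
  have hint' : ∀ a ∈ Set.range δ, ∀ b ∈ Set.range δ, ∃ n : ℤ, B a b = n :=
    fun a ha b hb => hΔ.integral a (hδsub ha) b (hδsub hb)
  -- the transvections along the basis vectors, as units of `Γ'`
  let T : Fin r → (V →ₗ[ℚ] V)ˣ := fun i =>
    LinearMap.GeneralLinearGroup.ofLinearEquiv (skewTransvectionEquiv B (hB.self_eq_zero (δ i)))
  have hTval : ∀ i, ((T i : (V →ₗ[ℚ] V)ˣ) : V →ₗ[ℚ] V) = skewTransvection B (δ i) := fun i => rfl
  have hTΓ' : ∀ i, T i ∈ Γ' := fun i =>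
    unit_skewTransvection_mem_transvectionGroup B (Set.mem_range_self i) (hB.self_eq_zero (δ i))
  -- membership in `Δ'`
  have hmemΔ' : ∀ x, x ∈ Δ' ↔ ∃ g ∈ Γ', ∃ i, ((g : (V →ₗ[ℚ] V)ˣ) : V →ₗ[ℚ] V) (δ i) = x := by
    intro x; rw [hΔ']; rfl
  have hδΔ' : ∀ i, δ i ∈ Δ' := fun i =>
    (hmemΔ' _).2 ⟨1, Γ'.one_mem, i, by rw [Units.val_one, Module.End.one_apply]⟩
  -- `Δ' ⊆ Δ`
  have hsubΔ : Δ' ⊆ Δ := by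
    intro x hx
    obtain ⟨g, hg, i, rfl⟩ := (hmemΔ' x).1 hx
    exact hΔ.stable g (hΓ'Γ hg) _ (hδΔ i)
  -- `ℤΔ' = ℤδ`
  have hspanZ : Submodule.span ℤ Δ' = Submodule.span ℤ (Set.range δ) := by
    refine le_antisymm (Submodule.span_le.2 fun x hx => ?_) (Submodule.span_mono fun x hx => ?_)
    · obtain ⟨g, hg, i, rfl⟩ := (hmemΔ' x).1 hx
      exact localTubeSpan_transvectionGroup_map_span_int B hB (Set.range δ) hint' hg
        (Submodule.subset_span ⟨i, rfl⟩)
    · obtain ⟨i, rfl⟩ := hx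
      exact hδΔ' i
  -- every element of `Δ'` is in the `Γ'`-orbit of the centre `c = δ i₀`
  have horbit : ∀ x ∈ Δ', ∃ a ∈ Γ', ((a : (V →ₗ[ℚ] V)ˣ) : V →ₗ[ℚ] V) (δ i₀) = x := by
    intro x hx
    obtain ⟨g, hg, i, rfl⟩ := (hmemΔ' x).1 hx
    by_cases hi : i = i₀
    · subst hi; exact ⟨g, hg, rfl⟩
    · refine ⟨g * (T i₀ * T i), Γ'.mul_mem hg (Γ'.mul_mem (hTΓ' i₀) (hTΓ' i)), ?_⟩
      rw [Units.val_mul, Units.val_mul, Module.End.mul_apply, Module.End.mul_apply, hTval, hTval,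
        localTubeSpan_star_move B hB (hstar i hi)]
  -- conjugates of basis transvections are the transvections along `Δ'`
  have hconjT : ∀ g ∈ Γ', ∀ i,
      LinearMap.GeneralLinearGroup.ofLinearEquiv
          (skewTransvectionEquiv B (hB.self_eq_zero (((g : (V →ₗ[ℚ] V)ˣ) : V →ₗ[ℚ] V) (δ i)))) =
        g * T i * g⁻¹ := by
    intro g hg i
    refine Units.ext (LinearMap.ext fun x => ?_)
    change skewTransvection B (((g : (V →ₗ[ℚ] V)ˣ) : V →ₗ[ℚ] V) (δ i)) x = _
    rw [skewTransvection_apply, Units.val_mul, Units.val_mul, Module.End.mul_apply,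
      Module.End.mul_apply, hTval, skewTransvection_apply, map_sub, map_smul,
      localTubeSpan_units_apply_inv_apply,
      ← localTubeSpan_transvectionGroup_isometry B hB (Set.range δ) hg
        (((g⁻¹ : (V →ₗ[ℚ] V)ˣ) : V →ₗ[ℚ] V) x) (δ i), localTubeSpan_units_apply_inv_apply]
  -- `Γ_{Δ'} = Γ'`
  have hΓeq : transvectionGroup B Δ' = Γ' := by
    refine le_antisymm ?_ (transvectionGroup_mono B fun x hx => ?_)
    · unfold transvectionGroup
      refine (Subgroup.closure_le _).2 ?_
      rintro u ⟨x, hx, hu⟩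
      obtain ⟨g, hg, i, rfl⟩ := (hmemΔ' x).1 hx
      have hueq : u = g * T i * g⁻¹ := by
        rw [← hconjT g hg i]
        exact Units.ext hu
      rw [hueq]
      exact Γ'.mul_mem (Γ'.mul_mem hg (hTΓ' i)) (Γ'.inv_mem hg)
    · obtain ⟨i, rfl⟩ := hx
      exact hδΔ' i
  refine ⟨hsubΔ, hspanZ, hΓeq, ⟨?_, ?_, ?_, ?_, ?_, ?_⟩⟩
  · rw [hspanZ]
    exact Submodule.fg_span (Set.finite_range δ)
  · exact fun a ha b hb => hΔ.integral a (hsubΔ ha) b (hsubΔ hb)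
  · refine eq_top_iff.2 ?_
    rw [← hsp]
    exact Submodule.span_mono fun x ⟨i, hi⟩ => hi ▸ hδΔ' i
  · intro γ hγ x hx
    rw [hΓeq] at hγ
    obtain ⟨g, hg, i, rfl⟩ := (hmemΔ' x).1 hx
    exact (hmemΔ' _).2 ⟨γ * g, Γ'.mul_mem hγ hg, i, by rw [Units.val_mul, Module.End.mul_apply]⟩
  · intro x hx y hy
    obtain ⟨a, ha, rfl⟩ := horbit x hx
    obtain ⟨a', ha', rfl⟩ := horbit y hy
    refine ⟨a' * a⁻¹, by rw [hΓeq]; exact Γ'.mul_mem ha' (Γ'.inv_mem ha), ?_⟩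
    rw [Units.val_mul, Module.End.mul_apply, localTubeSpan_units_inv_apply_apply]
  · exact ⟨δ i₁, hδΔ' i₁, δ i₀, hδΔ' i₀, hstar i₁ hi₁⟩

end Summit.HodgeConjecture.HodgeConjecture.Theorems

end
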